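import Summits.Ventures.HodgeRepro2.T6N41PlaceKappaHyp
import Summits.Ventures.HodgeRepro2.T6N41PlaceSplitMain

/-!
# T6N41PlaceKappaMain — (A″κ) from Rao's Corollary A.5 (1) modulo the local convention identity (Tier 6, M2; proof lane; owner t6-p4)

`kappa_eq_hilbert`: at a split `v ∉ S`, if the convention character of the type-II section is the inverse of
the Weil-index quotient `κ′(ϖ_v) = γ_F(ϖ_v, ψ_v) · γ_F(ϖ_v, tψ_v)⁻¹` (the residual `hκ'` — TIER5 §N4.1.10 Lemma
A′-4 (b4)–(b6), the comparison of GR91's Schrödinger model on `L²(W₁)` with the type-II model on `𝒮(X)` through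
the partial Fourier transform, NOT formalised), then `κ_v(ϖ_v) = (ϖ_v, t)_v`: Rao's Corollary A.5 (1) gives
`γ_F(ϖ_v, tψ_v) = (ϖ_v, t)_v γ_F(ϖ_v, ψ_v)`, so `κ′(ϖ_v) = (ϖ_v, t)_v⁻¹` and `κ_v(ϖ_v) = (ϖ_v, t)_v` — pure `ℂˣ`
algebra after the display.

`hκ_of_kappa`: `γ_D(𝔓₁) = λ_D(ϖ_w) · (ϖ_v, t)_v⁻¹` (the definition of `γ_D`, `γD_def`) `= λ_D(ϖ_w) · κ_v(ϖ_v)⁻¹`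
(`kappa_eq_hilbert`) `= μ₂` (`μ₂_eq`) — the residual `hκ` of `T6N41PlaceSplitMain.satake_split` DISCHARGED modulo
`hκ'` and the display.

`N41_placement_kappa`: the unramified identity `hunr` with both halves of (P7) discharged modulo the ONE residual
`hκ'` — SEVEN displays by name (LR §7 / §10, Bump (5.22), Harris II (2.2.5)(b), Rogawski §11.4, Mínguez Thm 1 (2),
Bump Thm 4.5.1, Rao Cor. A.5 (1)), the dichotomy `hdich`, the residual `hκ'`.  The residual census of the
placement moves from «`γ_D(𝔓₁) = μ₂`, a global-character identity» (AD) to «`κ_v(ϖ_v) = κ′(ϖ_v)⁻¹`, a local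
identity between two normalisations of the Weil representation of `Sp(𝕎_v)`» (AD, narrower: neither the global
datum, nor `E`, nor the inner form enters it — §N4.1.9 (d)).  `#print axioms` = {propext, Classical.choice,
Quot.sound}.

§8(d): uses an L-value-free non-vanishing device: NO.
-/

namespace Summit.Ventures.HodgeRepro2.T6
namespace N41Place

variable {ι : Type*} {D : DoublingLDatum ι} {Pl : PlacementDatum D} {In : InertDatum Pl} {Sp : SplitDatum In}

/-- **The convention character is the Hilbert symbol `(ϖ_v, t)_v`** (TIER5 §N4.1.10 Lemma A′-4, conclusion),
from Rao's Corollary A.5 (1) (`hRao`) and the local convention identity `hκ'` (Lemma A′-4 (b4)–(b6), the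
residual). -/
theorem kappa_eq_hilbert (Kd : KappaDatum Sp) (hRao : Hyp.Rao1993_CorA5_1 Kd)
    -- [residual: AD — TIER5 §N4.1.10 Lemma A′-4 (b4)–(b6): the type-II section `s_II` and GR91's `λ`-free section
    -- `s_v^{1}` differ on the torus element `K_{ϖ_v}` by the Weil-index quotient `κ′(ϖ_v)`, so that
    -- `κ_v(ϖ_v) = κ′(ϖ_v)⁻¹` (two Schrödinger models, the partial Fourier transform, Stone–von Neumann — not
    -- formalised; a statement about `Sp(𝕎_v)` and `(F_v, ψ_v)` alone)]
    (hκ' : ∀ v, Sp.splitPlace v → v ∉ D.S → Kd.κv v = (Kd.κ' v)⁻¹) :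
    ∀ v, Sp.splitPlace v → v ∉ D.S → Kd.κv v = Kd.hilbert v (Kd.ϖ v) (Kd.t v) := by
  intro v hv hS
  rw [hκ' v hv hS, KappaDatum.κ', hRao v (Kd.ϖ v) (Kd.t v) (Kd.ψ v)]
  -- `(γ * (h * γ)⁻¹)⁻¹ = (h * γ) * γ⁻¹ = h` in the group `ℂˣ`
  rw [mul_inv_rev, inv_inv, mul_inv_cancel_right]

/-- **(A″κ) discharged modulo `hκ'`:** `γ_D(𝔓₁) = μ₂` at every split `v ∉ S`, from the definition of `γ_D`
(`γD_def`), the elementary decomposition `μ₂ = λ_{D,w} κ_v⁻¹` (`μ₂_eq`) and `kappa_eq_hilbert`. -/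
theorem hκ_of_kappa (Kd : KappaDatum Sp) (hRao : Hyp.Rao1993_CorA5_1 Kd)
    (hκ' : ∀ v, Sp.splitPlace v → v ∉ D.S → Kd.κv v = (Kd.κ' v)⁻¹) :
    ∀ v, Sp.splitPlace v → v ∉ D.S → In.γD (Sp.p₁ v) = Sp.μ₂ v := by
  intro v hv hS
  rw [Kd.γD_def v hv hS, Kd.μ₂_eq v hv hS, kappa_eq_hilbert Kd hRao hκ' v hv hS]

/-- **The placement (P7) in kernel modulo the local convention identity `hκ'`:** the unramified identity
`hunr` of `N41_mainE` / `N4_main` from the seven displays by name, the dichotomy and `hκ'`. -/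
theorem N41_placement_kappa (D : DoublingLDatum ι) (Pl : PlacementDatum D) (In : InertDatum Pl)
    (Sp : SplitDatum In) (L : SplitLQ Sp) (Kd : KappaDatum Sp)
    (hLR7 : Hyp.LapidRallis2005_Sec7_Unramified D Pl) (hB : Hyp.Bump1997_5_22 Pl)
    (hHa : Hyp.HarrisII2007_Prop2_2_5_b In) (hRo : Hyp.Rogawski1990_Sec11_4_BC In)
    (hM : Hyp.Minguez2008_Thm1_2_LQ L) (hB451 : Hyp.Bump1997_Thm4_5_1 L)
    (hRao : Hyp.Rao1993_CorA5_1 Kd)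
    (hdich : ∀ 𝔓, Pl.b 𝔓 ∉ D.S → In.inert 𝔓 ∨ Sp.splitPlace (Pl.b 𝔓))
    -- [residual: AD — TIER5 §N4.1.10 Lemma A′-4 (b4)–(b6), the local convention identity `κ_v(ϖ_v) = κ′(ϖ_v)⁻¹`]
    (hκ' : ∀ v, Sp.splitPlace v → v ∉ D.S → Kd.κv v = (Kd.κ' v)⁻¹) :
    ∀ v ∉ D.S, ∀ s : ℂ, D.Lv v s = D.g₁ v s * D.g₂ v s :=
  N41_placement_split D Pl In Sp L hLR7 hB hHa hRo hM hB451 hdich (hκ_of_kappa Kd hRao hκ')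

end N41Place
end Summit.Ventures.HodgeRepro2.T6
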